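import Summits.RiemannHypothesis.RiemannHypothesis.Theorems.TiltedLandingLaw421R3BudgetAlgebra

/-!
# K-2 budget, regime (A) = compactification lemma (L1): the v-disc alone pays when `t_v ≥ 3/2` (C1 g35, W-08 ⟨33346⟩; D4b groundwork)

GEOMETRY-FREE.  Data: a state `v` (`a = Im v > 0`), its field `K` with DROP PARAMETER `t := −a·Im K ≥ 3/2` (i.e. `Im R_v` very negative), the floor
`30 ≤ a·κ` (`κ = ‖K + i/(2a)‖`), and a child `u` in the CLOSED sharp Newton disc `‖u − (v − K⁻¹)‖ ≤ (9/5)(μ₀/(a‖K‖)²)/‖K‖`, `0 ≤ μ₀ ≤ 1/2`.  Conclusion: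
`3 − 3/(a·κ) ≤ (a² − Im u²)·κ²` — the v-disc's weighted drop alone exceeds the whole budget target `3 − 15/λ` of `GeometricBudget 10 (1/2)`, so in the
certified check (instr-1 E2) the coordinate `t_v` may be restricted to `[T_v/2, 3/2]` (memo v2 §4 (A), compactification note (L1)).  Proof: H's closed-door
drop (I1) + currency (I2) reduce it to the pure-real `regimeA_real` in the variables `k = aκ`, `L = a‖K‖` (`L² = k² + t − 1/4`, `3/2 ≤ t ≤ L`).
STATUS: support lemma; `GeometricBudget 10 (1/2)` is NOT proved.  Nothing here bears on the truth of RH; RH is not proved; 33346 / 33347 OPEN. -/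

namespace RhW08.BudgetRegimeA

open Complex
open RhW08.BudgetAlgebra (energy_drop_closedDisc neg_im_mul_le normSq_tilt_t)
open RhW08.LightIsolatedChild (im_newtonPoint)

/-- (L1, real core) with `k = aκ ≥ 30`, `L = a‖K‖`, `L² = k² + t − 1/4`, `3/2 ≤ t ≤ L`, `0 ≤ μ₀ ≤ 1/2`:
`3 − 3/k ≤ 2tk²/L² − k²t²/L⁴ − (18/5)μ₀k²/L³ − (81/25)μ₀²k²/L⁶`. -/
theorem regimeA_real {k L t μ₀ : ℝ} (hk : 30 ≤ k) (hkL : L ^ 2 = k ^ 2 + t - 1 / 4) (ht : 3 / 2 ≤ t) (htL : t ≤ L)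
    (hμ0 : 0 ≤ μ₀) (hμ : μ₀ ≤ 1 / 2) :
    3 - 3 / k ≤ 2 * t * k ^ 2 / L ^ 2 - k ^ 2 * t ^ 2 / L ^ 4 - (18 / 5) * μ₀ * k ^ 2 / L ^ 3 - (81 / 25) * μ₀ ^ 2 * k ^ 2 / L ^ 6 := by
  have hk0 : 0 < k := by linarith
  have hL : k ≤ L := by nlinarith
  have hL0 : 0 < L := by linarith
  have hL30 : 30 ≤ L := hk.trans hL
  have hk2 : k ^ 2 = L ^ 2 - (t - 1 / 4) := by linarith
  have hk2L : k ^ 2 ≤ L ^ 2 := by nlinarith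
  have hL2 : 0 < L ^ 2 := by positivity
  have hL3 : 0 < L ^ 3 := by positivity
  have hL4 : 0 < L ^ 4 := by positivity
  have hL6 : 0 < L ^ 6 := by positivity
  -- main terms: 3 − 6/L² ≤ 2tk²/L² − k²t²/L⁴, polynomially (t − 3/2)·L²·(2L² − 3t − 4) + t²(t − 1/4) ≥ 0
  have hpoly : 3 * L ^ 4 - 6 * L ^ 2 ≤ 2 * t * k ^ 2 * L ^ 2 - k ^ 2 * t ^ 2 := by
    rw [hk2]
    have h1 : 0 ≤ (t - 3 / 2) * L ^ 2 * (2 * L ^ 2 - 3 * t - 4) :=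
      mul_nonneg (mul_nonneg (by linarith) hL2.le) (by nlinarith)
    have h2 : 0 ≤ t ^ 2 * (t - 1 / 4) := mul_nonneg (sq_nonneg t) (by linarith)
    nlinarith
  have hmain : 3 - 6 / L ^ 2 ≤ 2 * t * k ^ 2 / L ^ 2 - k ^ 2 * t ^ 2 / L ^ 4 := by
    have e1 : 3 - 6 / L ^ 2 = (3 * L ^ 4 - 6 * L ^ 2) / L ^ 4 := by field_simp
    have e2 : 2 * t * k ^ 2 / L ^ 2 - k ^ 2 * t ^ 2 / L ^ 4 = (2 * t * k ^ 2 * L ^ 2 - k ^ 2 * t ^ 2) / L ^ 4 := by field_simp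
    rw [e1, e2]
    exact div_le_div_of_nonneg_right hpoly hL4.le
  -- door terms
  have hdoor1 : (18 / 5) * μ₀ * k ^ 2 / L ^ 3 ≤ (9 / 5) / L := by
    rw [div_le_div_iff₀ hL3 hL0]
    nlinarith [mul_nonneg hμ0 (sub_nonneg.mpr hk2L), mul_le_mul_of_nonneg_right hμ (sq_nonneg k)]
  have hdoor2 : (81 / 25) * μ₀ ^ 2 * k ^ 2 / L ^ 6 ≤ (81 / 100) / L ^ 4 := by
    rw [div_le_div_iff₀ hL6 hL4]
    have hμ2 : μ₀ ^ 2 ≤ 1 / 4 := by nlinarith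
    have : μ₀ ^ 2 * k ^ 2 ≤ (1 / 4) * L ^ 2 := by nlinarith [mul_le_mul hμ2 hk2L (sq_nonneg k) (by norm_num : (0:ℝ) ≤ 1 / 4)]
    nlinarith
  -- bookkeeping: 6/L² + (9/5)/L + (81/100)/L⁴ ≤ 3/L ≤ 3/k
  have hb1 : 6 / L ^ 2 ≤ (1 / 5) / L := by
    rw [div_le_div_iff₀ hL2 hL0]; nlinarith
  have hb2 : (81 / 100) / L ^ 4 ≤ (1 / 100) / L := by
    rw [div_le_div_iff₀ hL4 hL0]
    have : (81:ℝ) ≤ L ^ 3 := by nlinarith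
    nlinarith
  have hb3 : 3 / L ≤ 3 / k := div_le_div_of_nonneg_left (by norm_num) hk0 hL
  have hb4 : (1 / 5) / L + (9 / 5) / L + (1 / 100) / L ≤ 3 / L := by
    rw [← add_div, ← add_div]; exact div_le_div_of_nonneg_right (by norm_num) hL0.le
  linarith

/-- (L1) REGIME (A): `t_v ≥ 3/2` ⇒ the v-disc alone pays `3 − 3/λ` (`λ = a·κ`), geometry-free. -/
theorem vdisc_regimeA {v K u : ℂ} {μ₀ : ℝ} (hv : 0 < v.im) (hμ0 : 0 ≤ μ₀) (hμ : μ₀ ≤ 1 / 2)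
    (hfl : 30 ≤ v.im * ‖K + I / (2 * (v.im : ℂ))‖) (ht : 3 / 2 ≤ -(v.im * K.im))
    (hd : ‖u - (v - K⁻¹)‖ ≤ (9 / 5) * (μ₀ / (v.im * ‖K‖) ^ 2) / ‖K‖) :
    3 - 3 / (v.im * ‖K + I / (2 * (v.im : ℂ))‖) ≤ (v.im ^ 2 - u.im ^ 2) * ‖K + I / (2 * (v.im : ℂ))‖ ^ 2 := by
  set a := v.im with ha
  set n := ‖K‖ with hn
  set κ := ‖K + I / (2 * (a : ℂ))‖ with hκ
  set t := -(a * K.im) with htdef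
  set δ := (9 / 5) * (μ₀ / (a * n) ^ 2) / n with hδ
  have hKim : K.im < 0 := by nlinarith
  have hK0 : K ≠ 0 := fun h => by rw [h] at hKim; simp at hKim
  have hn0 : 0 < n := norm_pos_iff.mpr hK0
  have htL : t ≤ a * n := neg_im_mul_le hv.le
  have hκ2 : κ ^ 2 = n ^ 2 - (t - 1 / 4) / a ^ 2 := normSq_tilt_t K hv.ne'
  have hκ0 : 0 ≤ κ := norm_nonneg _
  have hδ0 : 0 ≤ δ := by positivity
  -- L := a n ≥ k := a κ ≥ 30
  have hkL : (a * n) ^ 2 = (a * κ) ^ 2 + t - 1 / 4 := by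
    rw [mul_pow, mul_pow, hκ2]; field_simp; ring
  have hLk : a * κ ≤ a * n := by nlinarith [mul_nonneg hv.le hκ0, mul_nonneg hv.le hn0.le]
  have hL1 : 1 ≤ a * n := by linarith
  -- the centre height is in [0, a]
  have hc : |(v - K⁻¹).im| ≤ a := by
    rw [im_newtonPoint]
    have e : K.im = -t / a := by rw [htdef]; field_simp
    have h1 : 0 ≤ t / (a * n ^ 2) := by positivity
    have h2 : t / (a * n ^ 2) ≤ a := by
      rw [div_le_iff₀ (by positivity)]
      nlinarith [mul_nonneg hv.le hn0.le]
    have e2 : a + K.im / n ^ 2 = a - t / (a * n ^ 2) := by rw [e]; field_simp; ring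
    rw [← ha, e2, abs_le]
    constructor <;> linarith
  -- closed-door drop (H (I1)) with |c| ≤ a
  have hdrop := energy_drop_closedDisc hd
  have hdrop' : 2 * t / n ^ 2 - t ^ 2 / (a ^ 2 * n ^ 4) - 2 * a * δ - δ ^ 2 ≤ a ^ 2 - u.im ^ 2 := by
    have e1 : 2 * (-(v.im * K.im)) / ‖K‖ ^ 2 = 2 * t / n ^ 2 := by rw [htdef]
    have e2 : K.im ^ 2 / ‖K‖ ^ 4 = t ^ 2 / (a ^ 2 * n ^ 4) := by rw [htdef, ← hn]; field_simp
    have h3 : 2 * |(v - K⁻¹).im| * δ ≤ 2 * a * δ := by nlinarith [abs_nonneg ((v - K⁻¹).im)]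
    rw [e1, e2] at hdrop
    linarith
  have hV : κ ^ 2 * (2 * t / n ^ 2 - t ^ 2 / (a ^ 2 * n ^ 4) - 2 * a * δ - δ ^ 2) ≤ (a ^ 2 - u.im ^ 2) * κ ^ 2 := by
    rw [mul_comm]; exact mul_le_mul_of_nonneg_right hdrop' (sq_nonneg κ)
  -- rewrite the left side in the variables k = aκ, L = an
  have hkey : κ ^ 2 * (2 * t / n ^ 2 - t ^ 2 / (a ^ 2 * n ^ 4) - 2 * a * δ - δ ^ 2) =
      2 * t * (a * κ) ^ 2 / (a * n) ^ 2 - (a * κ) ^ 2 * t ^ 2 / (a * n) ^ 4 - (18 / 5) * μ₀ * (a * κ) ^ 2 / (a * n) ^ 3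
        - (81 / 25) * μ₀ ^ 2 * (a * κ) ^ 2 / (a * n) ^ 6 := by
    rw [hδ]; field_simp; ring
  have hreal := regimeA_real (k := a * κ) (L := a * n) hfl hkL ht htL hμ0 hμ
  rw [← hkey] at hreal
  exact hreal.trans hV

end RhW08.BudgetRegimeA
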